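import Literature.MathematicalPhysics.QuantumLattice.GrassmannWeightedLaplacianPatternPrescribed
import Literature.MathematicalPhysics.QuantumLattice.GrassmannVertexPositionsOriented
import HarnessLib

/-!
# One consistent pattern of one script, decay-WEIGHTED, with ORIENTED lines and sector levels (BGM 2006, App. A4 (A4.8))

Topic `Literature/MathematicalPhysics/QuantumLattice`; the `IsTreeWeight wt`-weighted twin of `GrassmannVertexPositionsOriented`
(`sum_kerProdR_mul_lapWt_le_oriented`), obtained from it exactly as `GrassmannWeightedLaplacianPatternPrescribed.sum_wt_kerProd_mul_lapWt_le_of_pinnable`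
is obtained from `sum_kerProd_mul_lapWt_le_of_pinnable`: the weight of the output label set is dominated by the product of the weights of
the input label sets and of the tree lines (`IsTreeWeight.wt_image_le_prod`), so the weighted estimate is the unweighted one for the
weighted kernels `‖K_u‖·wt` and the weighted covariance `C·wt` (Benfatto–Giuliani–Mastropietro 2006, §3 (3.2)–(3.8) riding on the
sectorised tree bound of App. A4).

* `sum_wt_kerProdR_mul_lapWt_le_oriented` — the weighted oriented one-pattern estimate.

Everything is proved; no named fact.

## Sources

G. Benfatto, A. Giuliani, V. Mastropietro, Ann. Henri Poincaré 7 (2006) 809–898, proof of (2.77), §3 (3.2)–(3.8), App. A4 (A4.8)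
(`BenfattoGiulianiMastropietro2006`).
-/

noncomputable section

namespace Literature.MathematicalPhysics.QuantumLattice

open GrassmannAlgebra Finset
open Literature.Probability.LatticeModels Literature.Probability.LatticeModels.BattleFederbush

variable {𝕜 : Type*} [RCLike 𝕜] {Γ : Type*} [Fintype Γ] [DecidableEq Γ] {n : ℕ}
variable (C : Matrix Γ Γ 𝕜) (cl : Γ → Fin n) {deg : Fin n → ℕ} (K : ∀ v : Fin n, (Fin (deg v) → Γ) → 𝕜)
variable {wt : Finset Γ → ℝ} {Sec : Type*} [Fintype Sec] [DecidableEq Sec]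

/-- **The weighted oriented tree-decay estimate for one script and one consistent pattern** (twin of
`sum_wt_kerProd_mul_lapWt_le_of_pinnable` over `sum_kerProdR_mul_lapWt_le_oriented`): for a tree weight `wt`, with the data of
`sum_kerProdR_mul_lapWt_le_oriented` — sectors, talking relation, restricted kernels, a reading `o` of the lines, levelled
`wt`-WEIGHTED anchored norms (`hN`: full pin, `hNsw`: position-only pin) — and `wt`-weighted row/column sums of the type-restricted
covariance `≤ α`,
`Σ_{x : x_{p₀} = w} wt(x) (∏_u ‖K_u(x|_u)‖_ρ) · lapWt(lines, π, x) ≤ (c·α/2)^k ∏_u Nv u (levR ρ u + swChildren u + [u = v₀ ∨ o u])`.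
[cite: BenfattoGiulianiMastropietro2006, App. A4 (A4.8); proof of (2.77) and §3 (3.2)-(3.8)] -/
theorem sum_wt_kerProdR_mul_lapWt_le_oriented (hwt : IsTreeWeight wt) (Pn : Fin (∑ v, deg v) → Prop) (sec : Γ → Sec)
    (ov : Sec → Sec → Prop) [DecidableRel ov] {c : ℕ} (hc1 : 1 ≤ c)
    (hov : ∀ σ' : Sec, (univ.filter fun σ : Sec => ov σ σ').card ≤ c)
    (hCov : ∀ ℓ X Y, typeRestrict C cl ℓ X Y ≠ 0 → ov (sec X) (sec Y) ∧ ov (sec Y) (sec X))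
    (Nv : Fin n → ℕ → ℝ) (hN0 : ∀ u F, 0 ≤ Nv u F)
    (hN : ∀ (ρ' : Fin (∑ v, deg v) → Option Sec) (u : Fin n) (j : Fin (deg u)), Pn (blockEmb deg u j) →
      ρ' (blockEmb deg u j) = none → ∀ a : Γ,
      ∑ Y ∈ univ.filter (fun Y : Fin (deg u) → Γ => Y j = a),
        (if ∀ j' σ, ρ' (blockEmb deg u j') = some σ → sec (Y j') = σ then ‖K u Y‖ * wt (univ.image Y) else 0) ≤
        Nv u (levR (vert deg) ρ' u + 1))
    (hNsw : ∀ (ρ' : Fin (∑ v, deg v) → Option Sec) (u : Fin n) (j : Fin (deg u)), Pn (blockEmb deg u j) →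
      ρ' (blockEmb deg u j) = none → ∃ g : Sec → ℝ, (∀ σ, 0 ≤ g σ) ∧
      (∀ a : Γ, ∑ Y ∈ univ.filter (fun Y : Fin (deg u) → Γ => Y j = a),
        (if ∀ j' σ, ρ' (blockEmb deg u j') = some σ → sec (Y j') = σ then ‖K u Y‖ * wt (univ.image Y) else 0) ≤
          g (sec a)) ∧
      ∑ σ, g σ ≤ Nv u (levR (vert deg) ρ' u))
    {α : ℝ} (hα : 0 ≤ α) (hrow : ∀ ℓ X, ∑ Y, ‖typeRestrict C cl ℓ X Y‖ * wt {X, Y} ≤ α)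
    (hcol : ∀ ℓ Y, ∑ X, ‖typeRestrict C cl ℓ X Y‖ * wt {X, Y} ≤ α)
    {v₀ : Fin n} {k : ℕ} (s : Script v₀ k) (hs : s.Valid) (hcov : univ.image s.y = univ)
    (π : List (Fin (∑ v, deg v) × Fin (∑ v, deg v))) (hπ : ∀ pq ∈ π, Pn pq.1 ∧ Pn pq.2)
    (hπnd : (π.map Prod.fst ++ π.map Prod.snd).Nodup)
    (o : Fin n → Bool) (ρ : Fin (∑ v, deg v) → Option Sec) (hρ : ∀ τ, Pn τ → ρ τ = none)
    (p₀ : Fin (∑ v, deg v)) (hp₀ : vert deg p₀ = v₀) (hP₀ : Pn p₀) (hp₀π : ∀ pq ∈ π, pq.1 ≠ p₀ ∧ pq.2 ≠ p₀) (w : Γ) :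
    ∑ x ∈ univ.filter (fun x : Fin (∑ v, deg v) → Γ => x p₀ = w), wt (univ.image x) *
        ((∏ u, restrictK (vert deg) sec ρ (fun u x => ‖K u fun j => x (blockEmb deg u j)‖) u x) *
          lapWt C cl deg s.lines.reverse π x) ≤
      (c * (α / 2)) ^ k * ∏ u, Nv u (levR (vert deg) ρ u + swChildren s o u + if u = v₀ ∨ o u = true then 1 else 0) := by
  -- the weighted kernels and covariance
  set Kw : ∀ v : Fin n, (Fin (deg v) → Γ) → 𝕜 := fun u Yu => (((‖K u Yu‖ * wt (univ.image Yu) : ℝ)) : 𝕜) with hKw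
  set Cw : Matrix Γ Γ 𝕜 := Matrix.of fun X Y => C X Y * ((wt {X, Y} : ℝ) : 𝕜) with hCw
  have hKw_norm : ∀ u Yu, ‖Kw u Yu‖ = ‖K u Yu‖ * wt (univ.image Yu) := fun u Yu => by
    rw [hKw]; dsimp only
    rw [RCLike.norm_ofReal, abs_of_nonneg (mul_nonneg (norm_nonneg _) (hwt.nonneg _))]
  have hCw_norm : ∀ ℓ X Y, ‖typeRestrict Cw cl ℓ X Y‖ = ‖typeRestrict C cl ℓ X Y‖ * wt {X, Y} := fun ℓ X Y => by
    simp only [typeRestrict_apply, hCw, Matrix.of_apply]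
    split_ifs
    · rw [norm_mul, RCLike.norm_ofReal, abs_of_nonneg (hwt.nonneg _)]
    · rw [norm_zero, zero_mul]
  -- restricted products of the weighted kernels
  have hRK : ∀ (u : Fin n) (x : Fin (∑ v, deg v) → Γ),
      restrictK (vert deg) sec ρ (fun u x => ‖Kw u fun j => x (blockEmb deg u j)‖) u x =
        restrictK (vert deg) sec ρ (fun u x => ‖K u fun j => x (blockEmb deg u j)‖) u x *
          wt (univ.image fun j : Fin (deg u) => x (blockEmb deg u j)) := by
    intro u x
    unfold restrictK
    split_ifs
    · exact hKw_norm u _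
    · rw [zero_mul]
  have hkerw : ∀ x : Fin (∑ v, deg v) → Γ, ∏ u, restrictK (vert deg) sec ρ (fun u x => ‖Kw u fun j => x (blockEmb deg u j)‖) u x =
      (∏ u, restrictK (vert deg) sec ρ (fun u x => ‖K u fun j => x (blockEmb deg u j)‖) u x) *
        ∏ u, wt (univ.image fun j : Fin (deg u) => x (blockEmb deg u j)) := by
    intro x
    rw [← prod_mul_distrib]
    exact prod_congr rfl fun u _ => hRK u x
  have hPR0 : ∀ (K₁ : ∀ v : Fin n, (Fin (deg v) → Γ) → 𝕜) (x : Fin (∑ v, deg v) → Γ),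
      0 ≤ ∏ u, restrictK (vert deg) sec ρ (fun u x => ‖K₁ u fun j => x (blockEmb deg u j)‖) u x := fun K₁ x =>
    prod_nonneg fun u _ => restrictK_nonneg _ _ _ (fun u x => norm_nonneg _) u x
  have hnd : s.lines.reverse.Nodup := List.nodup_reverse.2 (Script.nodup_lines s hs)
  -- the pointwise domination
  have hpt : ∀ x : Fin (∑ v, deg v) → Γ, wt (univ.image x) *
      ((∏ u, restrictK (vert deg) sec ρ (fun u x => ‖K u fun j => x (blockEmb deg u j)‖) u x) *
        lapWt C cl deg s.lines.reverse π x) ≤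
      (∏ u, restrictK (vert deg) sec ρ (fun u x => ‖Kw u fun j => x (blockEmb deg u j)‖) u x) *
        lapWt Cw cl deg s.lines.reverse π x := by
    intro x
    have hR0 : 0 ≤ (∏ u, restrictK (vert deg) sec ρ (fun u x => ‖Kw u fun j => x (blockEmb deg u j)‖) u x) *
        lapWt Cw cl deg s.lines.reverse π x := mul_nonneg (hPR0 Kw x) (lapWt_nonneg Cw cl deg _ _ _)
    by_cases hc : stepsOK (s.lines.reverse.map (lapPred deg)) π = true
    swap
    · rw [lapWt_eq C cl x _ π hnd, if_neg hc, mul_zero, mul_zero]; exact hR0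
    -- the slots of the lines
    set e : Sym2 (Fin n) → Fin (∑ v, deg v) × Fin (∑ v, deg v) := fun ℓ =>
      match (s.lines.reverse.zip π).find? (fun z => decide (z.1 = ℓ)) with
      | some z => (z.2.2, z.2.1)
      | none => (p₀, p₀) with he
    have he' : ∀ ℓ ∈ s.lines, ∃ pq, (s.lines.reverse.zip π).find? (fun z => decide (z.1 = ℓ)) = some (ℓ, pq) ∧
        s(vert deg pq.2, vert deg pq.1) = ℓ ∧ e ℓ = (pq.2, pq.1) := by
      intro ℓ hℓ
      obtain ⟨pq, hfind, hpq⟩ := exists_find_of_stepsOK (deg := deg) s.lines.reverse π hc ℓ (List.mem_reverse.2 hℓ)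
      refine ⟨pq, hfind, hpq, ?_⟩
      simp only [he, hfind]
    have hev : ∀ ℓ ∈ s.lines, s(vert deg (e ℓ).1, vert deg (e ℓ).2) = ℓ := by
      intro ℓ hℓ
      obtain ⟨pq, -, hpq, heq⟩ := he' ℓ hℓ
      rw [heq]; exact hpq
    -- the line weights of the weighted covariance
    have hline : ∀ ℓ ∈ s.lines.reverse, lineWt Cw cl (s.lines.reverse.zip π) ℓ x =
        lineWt C cl (s.lines.reverse.zip π) ℓ x * wt {x (e ℓ).1, x (e ℓ).2} := by
      intro ℓ hℓ
      obtain ⟨pq, hfind, -, heq⟩ := he' ℓ (List.mem_reverse.1 hℓ)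
      rw [lineWt, lineWt, hfind, heq]
      dsimp only
      rw [hCw_norm, mul_assoc]
    have hlap : lapWt Cw cl deg s.lines.reverse π x =
        lapWt C cl deg s.lines.reverse π x * (s.lines.reverse.map fun ℓ => wt {x (e ℓ).1, x (e ℓ).2}).prod := by
      rw [lapWt_eq Cw cl x _ π hnd, lapWt_eq C cl x _ π hnd, if_pos hc, if_pos hc, List.map_congr_left hline, List.prod_map_mul]
    -- the tree product bound
    have htree := hwt.wt_image_le_prod (vert deg) x e s hs hev
    have hfilt : (univ.filter fun τ : Fin (∑ v, deg v) => vert deg τ ∈ univ.image s.y) = univ := by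
      rw [hcov]; exact filter_true_of_mem fun τ _ => mem_univ _
    rw [hfilt, hcov, ← List.prod_reverse, ← List.map_reverse] at htree
    simp only [image_filter_vert_eq] at htree
    have hK0 := hPR0 K x
    have hL0 := lapWt_nonneg C cl deg s.lines.reverse π x
    have hP0 : 0 ≤ ∏ u, wt (univ.image fun j : Fin (deg u) => x (blockEmb deg u j)) := prod_nonneg fun u _ => hwt.nonneg _
    have hM0 : 0 ≤ (s.lines.reverse.map fun ℓ => wt {x (e ℓ).1, x (e ℓ).2}).prod := hwt.prod_map_nonneg s.lines.reverse _
    rw [hkerw, hlap]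
    calc wt (univ.image x) * ((∏ u, restrictK (vert deg) sec ρ (fun u x => ‖K u fun j => x (blockEmb deg u j)‖) u x) *
          lapWt C cl deg s.lines.reverse π x)
        ≤ ((∏ u, wt (univ.image fun j : Fin (deg u) => x (blockEmb deg u j))) *
            (s.lines.reverse.map fun ℓ => wt {x (e ℓ).1, x (e ℓ).2}).prod) *
            ((∏ u, restrictK (vert deg) sec ρ (fun u x => ‖K u fun j => x (blockEmb deg u j)‖) u x) *
              lapWt C cl deg s.lines.reverse π x) := mul_le_mul_of_nonneg_right htree (mul_nonneg hK0 hL0)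
      _ = (∏ u, restrictK (vert deg) sec ρ (fun u x => ‖K u fun j => x (blockEmb deg u j)‖) u x) *
            (∏ u, wt (univ.image fun j : Fin (deg u) => x (blockEmb deg u j))) *
            (lapWt C cl deg s.lines.reverse π x * (s.lines.reverse.map fun ℓ => wt {x (e ℓ).1, x (e ℓ).2}).prod) := by ring
  -- the unweighted oriented lemma for the weighted data
  have hN' : ∀ (ρ' : Fin (∑ v, deg v) → Option Sec) (u : Fin n) (j : Fin (deg u)), Pn (blockEmb deg u j) →
      ρ' (blockEmb deg u j) = none → ∀ a : Γ,
      ∑ Y ∈ univ.filter (fun Y : Fin (deg u) → Γ => Y j = a),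
        (if ∀ j' σ, ρ' (blockEmb deg u j') = some σ → sec (Y j') = σ then ‖Kw u Y‖ else 0) ≤
        Nv u (levR (vert deg) ρ' u + 1) := by
    intro ρ' u j hj hρ' a; simp only [hKw_norm]; exact hN ρ' u j hj hρ' a
  have hNsw' : ∀ (ρ' : Fin (∑ v, deg v) → Option Sec) (u : Fin n) (j : Fin (deg u)), Pn (blockEmb deg u j) →
      ρ' (blockEmb deg u j) = none → ∃ g : Sec → ℝ, (∀ σ, 0 ≤ g σ) ∧
      (∀ a : Γ, ∑ Y ∈ univ.filter (fun Y : Fin (deg u) → Γ => Y j = a),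
        (if ∀ j' σ, ρ' (blockEmb deg u j') = some σ → sec (Y j') = σ then ‖Kw u Y‖ else 0) ≤ g (sec a)) ∧
      ∑ σ, g σ ≤ Nv u (levR (vert deg) ρ' u) := by
    intro ρ' u j hj hρ'; simp only [hKw_norm]; exact hNsw ρ' u j hj hρ'
  have hrow' : ∀ ℓ X, ∑ Y, ‖typeRestrict Cw cl ℓ X Y‖ ≤ α := fun ℓ X => by simp only [hCw_norm]; exact hrow ℓ X
  have hcol' : ∀ ℓ Y, ∑ X, ‖typeRestrict Cw cl ℓ X Y‖ ≤ α := fun ℓ Y => by simp only [hCw_norm]; exact hcol ℓ Y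
  have hCov' : ∀ ℓ X Y, typeRestrict Cw cl ℓ X Y ≠ 0 → ov (sec X) (sec Y) ∧ ov (sec Y) (sec X) := by
    intro ℓ X Y h
    refine hCov ℓ X Y fun h0 => h ?_
    have h1 := hCw_norm ℓ X Y
    rw [h0, norm_zero, zero_mul] at h1
    exact norm_eq_zero.1 h1
  exact (sum_le_sum fun x _ => hpt x).trans
    (sum_kerProdR_mul_lapWt_le_oriented Cw cl Kw Pn sec ov hc1 hov hCov' Nv hN0 hN' hNsw' hα hrow' hcol' s hs hcov π hπ hπnd
      o ρ hρ p₀ hp₀ hP₀ hp₀π w)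


/-! ### Patterns: positions, and the slots of a Laplacian segment are pairwise distinct -/

section Patterns

variable {N : ℕ}

omit [RCLike 𝕜] [Fintype Γ] [DecidableEq Γ] in
/-- Membership in the patterns of `o :: ops`. [folklore] -/
private theorem mem_patSet_cons' {o : DelOp Γ 𝕜} {ops : List (DelOp Γ 𝕜)} {S : Finset (Fin N)} {π : List (Fin N × Fin N)} :
    π ∈ patSet (o :: ops) S ↔ ∃ pq π', π = pq :: π' ∧ pq ∈ DelOp.stepSet S o ∧ π' ∈ patSet ops (DelOp.rest S o pq) := by
  rw [patSet, mem_map]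
  constructor
  · rintro ⟨⟨pq, π'⟩, h, rfl⟩
    exact ⟨pq, π', rfl, (mem_sigma.1 h).1, (mem_sigma.1 h).2⟩
  · rintro ⟨pq, π', rfl, h1, h2⟩
    exact ⟨⟨pq, π'⟩, mem_sigma.2 ⟨h1, h2⟩, rfl⟩

omit [RCLike 𝕜] [Fintype Γ] [DecidableEq Γ] in
/-- A step of an operation on `S` sits inside `S`. [folklore] -/
private theorem mem_of_mem_stepSet' (S : Finset (Fin N)) : ∀ (o : DelOp Γ 𝕜) {pq : Fin N × Fin N},
    pq ∈ DelOp.stepSet S o → pq.1 ∈ S ∧ pq.2 ∈ S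
  | DelOp.ext _, _, h => mem_product.1 (mem_filter.1 h).1
  | DelOp.lap _, _, h => mem_product.1 (mem_filter.1 h).1

omit [RCLike 𝕜] [Fintype Γ] [DecidableEq Γ] in
/-- The remaining positions are among the old ones. [folklore] -/
private theorem rest_subset' (S : Finset (Fin N)) : ∀ (o : DelOp Γ 𝕜) (pq : Fin N × Fin N), DelOp.rest S o pq ⊆ S
  | DelOp.ext _, _ => erase_subset _ _
  | DelOp.lap _, _ => (erase_subset _ _).trans (erase_subset _ _)

omit [RCLike 𝕜] [Fintype Γ] [DecidableEq Γ] in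
/-- The first position of a step is deleted. [folklore] -/
private theorem fst_not_mem_rest' (S : Finset (Fin N)) : ∀ (o : DelOp Γ 𝕜) (pq : Fin N × Fin N), pq.1 ∉ DelOp.rest S o pq
  | DelOp.ext _, _ => notMem_erase _ _
  | DelOp.lap _, pq => fun h => notMem_erase pq.1 S (mem_of_mem_erase h)

omit [RCLike 𝕜] [Fintype Γ] [DecidableEq Γ] in
/-- Every step of a pattern on `S` sits inside `S`. [folklore] -/
private theorem mem_of_mem_patSet' : ∀ (ops : List (DelOp Γ 𝕜)) (S : Finset (Fin N)) {π : List (Fin N × Fin N)},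
    π ∈ patSet ops S → ∀ pq ∈ π, pq.1 ∈ S ∧ pq.2 ∈ S
  | [], S, π, h, pq, hpq => by
    rw [patSet, mem_singleton] at h
    subst h
    exact absurd hpq List.not_mem_nil
  | o :: ops, S, π, h, pq, hpq => by
    obtain ⟨pq₀, π', rfl, h0, h'⟩ := mem_patSet_cons'.1 h
    rcases List.mem_cons.1 hpq with rfl | hpq'
    · exact mem_of_mem_stepSet' S o h0
    · have h'' := mem_of_mem_patSet' ops _ h' pq hpq'
      exact ⟨rest_subset' S o pq₀ h''.1, rest_subset' S o pq₀ h''.2⟩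

omit [RCLike 𝕜] [Fintype Γ] [DecidableEq Γ] in
/-- In a pattern, every later step avoids the first position of every earlier step. [folklore] -/
private theorem pairwise_of_mem_patSet' : ∀ (ops : List (DelOp Γ 𝕜)) (S : Finset (Fin N)) {π : List (Fin N × Fin N)},
    π ∈ patSet ops S → π.Pairwise fun pq pq' => pq'.1 ≠ pq.1 ∧ pq'.2 ≠ pq.1
  | [], S, π, h => by
    rw [patSet, mem_singleton] at h
    subst h
    exact List.Pairwise.nil
  | o :: ops, S, π, h => by
    obtain ⟨pq₀, π', rfl, h0, h'⟩ := mem_patSet_cons'.1 h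
    refine List.pairwise_cons.2 ⟨fun pq' hpq' => ?_, pairwise_of_mem_patSet' ops _ h'⟩
    have hm := mem_of_mem_patSet' ops _ h' pq' hpq'
    exact ⟨fun he => fst_not_mem_rest' S o pq₀ (he ▸ hm.1), fun he => fst_not_mem_rest' S o pq₀ (he ▸ hm.2)⟩

omit [RCLike 𝕜] [Fintype Γ] [DecidableEq Γ] in
/-- **The tail of a pattern of `ops₁ ++ ops₂` is a pattern of `ops₂`** on some subset of the positions. [folklore] -/
private theorem drop_mem_patSet : ∀ (ops₁ ops₂ : List (DelOp Γ 𝕜)) (S : Finset (Fin N)) {π : List (Fin N × Fin N)},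
    π ∈ patSet (ops₁ ++ ops₂) S → ∃ S' : Finset (Fin N), S' ⊆ S ∧ π.drop ops₁.length ∈ patSet ops₂ S'
  | [], ops₂, S, π, h => ⟨S, subset_rfl, by simpa using h⟩
  | o :: ops₁, ops₂, S, π, h => by
    rw [List.cons_append] at h
    obtain ⟨pq₀, π', rfl, h0, h'⟩ := mem_patSet_cons'.1 h
    obtain ⟨S', hS', hmem⟩ := drop_mem_patSet ops₁ ops₂ _ h'
    exact ⟨S', hS'.trans (rest_subset' S o pq₀), by rw [List.length_cons, List.drop_succ_cons]; exact hmem⟩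

omit [RCLike 𝕜] [Fintype Γ] [DecidableEq Γ] in
/-- **The slots of a pattern of Laplacian steps are pairwise distinct** (each step deletes both its positions), and lie in the
position set. [folklore] -/
private theorem nodup_slots_of_mem_patSet_laps : ∀ (ops : List (DelOp Γ 𝕜)), (∀ o ∈ ops, ∃ C' : Matrix Γ Γ 𝕜, o = DelOp.lap C') →
    ∀ (S : Finset (Fin N)) {π : List (Fin N × Fin N)}, π ∈ patSet ops S →
      (π.map Prod.fst ++ π.map Prod.snd).Nodup ∧ ∀ pq ∈ π, pq.1 ∈ S ∧ pq.2 ∈ S ∧ pq.1 ≠ pq.2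
  | [], _, S, π, h => by
    rw [patSet, mem_singleton] at h
    subst h
    exact ⟨by simp, fun pq hpq => absurd hpq List.not_mem_nil⟩
  | o :: ops, hops, S, π, h => by
    obtain ⟨C', rfl⟩ := hops o (by simp)
    obtain ⟨pq₀, π', rfl, h0, h'⟩ := mem_patSet_cons'.1 h
    have hstep : pq₀.1 ∈ S ∧ pq₀.2 ∈ S ∧ pq₀.2 ≠ pq₀.1 := by
      simp only [DelOp.stepSet, mem_filter, mem_product] at h0
      exact ⟨h0.1.1, h0.1.2, h0.2⟩
    obtain ⟨hnd', hin'⟩ := nodup_slots_of_mem_patSet_laps ops (fun o' ho' => hops o' (List.mem_cons_of_mem _ ho')) _ h'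
    have hrest : ∀ pq ∈ π', (pq.1 ∈ S ∧ pq.1 ≠ pq₀.1 ∧ pq.1 ≠ pq₀.2) ∧ (pq.2 ∈ S ∧ pq.2 ≠ pq₀.1 ∧ pq.2 ≠ pq₀.2) := by
      intro pq hpq
      obtain ⟨h1, h2, -⟩ := hin' pq hpq
      simp only [DelOp.rest, mem_erase] at h1 h2
      exact ⟨⟨h1.2.2, h1.2.1, h1.1⟩, ⟨h2.2.2, h2.2.1, h2.1⟩⟩
    obtain ⟨hn1, hn2, hcross⟩ := List.nodup_append.1 hnd'
    refine ⟨?_, fun pq hpq => ?_⟩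
    · rw [List.map_cons, List.map_cons]
      refine List.nodup_append.2 ⟨List.nodup_cons.2 ⟨fun hm => ?_, hn1⟩, List.nodup_cons.2 ⟨fun hm => ?_, hn2⟩, ?_⟩
      · obtain ⟨pq, hpq, he⟩ := List.mem_map.1 hm
        exact (hrest pq hpq).1.2.1 he
      · obtain ⟨pq, hpq, he⟩ := List.mem_map.1 hm
        exact (hrest pq hpq).2.2.2 he
      · intro a ha b hb
        rcases List.mem_cons.1 ha with rfl | ha'
        · rcases List.mem_cons.1 hb with rfl | hb'
          · exact hstep.2.2.symm
          · obtain ⟨pq, hpq, rfl⟩ := List.mem_map.1 hb'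
            exact fun he => (hrest pq hpq).2.2.1 he.symm
        · rcases List.mem_cons.1 hb with rfl | hb'
          · obtain ⟨pq, hpq, rfl⟩ := List.mem_map.1 ha'
            exact (hrest pq hpq).1.2.2
          · exact hcross a ha' b hb'
    · rcases List.mem_cons.1 hpq with rfl | hpq'
      · exact ⟨hstep.1, hstep.2.1, hstep.2.2.symm⟩
      · obtain ⟨h1, h2⟩ := hrest pq hpq'
        exact ⟨h1.1, h2.1, (hin' pq hpq').2.2⟩

end Patterns

omit [Fintype Γ] [DecidableEq Γ] in
/-- The Laplacian segment of a pattern of `scriptOps` has pairwise distinct slots. [folklore] -/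
private theorem nodup_drop_of_mem_patSet_scriptOps {r : ℕ} {W₀ : Fin r → Γ} {v₀ : Fin n} {k : ℕ} (s : Script v₀ k)
    {π : List (Fin (∑ v, deg v) × Fin (∑ v, deg v))} (hπ : π ∈ patSet (scriptOps C cl W₀ s) univ) :
    ((π.drop r).map Prod.fst ++ (π.drop r).map Prod.snd).Nodup := by
  unfold scriptOps at hπ
  obtain ⟨S', -, hmem⟩ := drop_mem_patSet _ _ _ hπ
  rw [List.length_map, List.length_ofFn] at hmem
  exact (nodup_slots_of_mem_patSet_laps _ (fun o' ho' => by
    obtain ⟨ℓ, -, rfl⟩ := List.mem_map.1 ho'; exact ⟨_, rfl⟩) S' hmem).1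

/-! ### One pattern with prescribed output sectors, weighted, oriented -/

/-- **The constrained output-label sum of the derivative steps**: with `W_i = w` and `A_j(W_j)` for `j ∈ J`,
`Σ_W weight(Z, ∂_W, π) ≤ [Z_{p_i} = w] ∏_{j∈J} [A_j(Z_{p_j})]`. [folklore] -/
private theorem sum_filter_patWeight_map_ext_le_prescribed' {N : ℕ} (Z : Fin N → Γ) {r : ℕ} (i : Fin r) (w : Γ)
    (J : Finset (Fin r)) (A : Fin r → Γ → Bool) (π : List (Fin N × Fin N)) (hr : r ≤ π.length) :
    ∑ W ∈ univ.filter (fun W : Fin r → Γ => W i = w ∧ ∀ j ∈ J, A j (W j) = true),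
        patWeight Z ((List.ofFn W).map DelOp.ext : List (DelOp Γ 𝕜)) π ≤
      (if Z (π[(i : ℕ)]'(lt_of_lt_of_le i.2 hr)).1 = w then (1 : ℝ) else 0) *
        ∏ j ∈ J, (if A j (Z (π[(j : ℕ)]'(lt_of_lt_of_le j.2 hr)).1) = true then (1 : ℝ) else 0) := by
  set z : Fin r → Γ := fun j => Z (π[(j : ℕ)]'(lt_of_lt_of_le j.2 hr)).1 with hz
  have hsome : ∀ j : Fin r, (π[(j : ℕ)]?).map (fun pq => Z pq.1) = some (z j) := fun j => by
    rw [List.getElem?_eq_getElem (lt_of_lt_of_le j.2 hr), Option.map_some]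
  have hprod : ∀ W : Fin r → Γ, patWeight Z ((List.ofFn W).map DelOp.ext : List (DelOp Γ 𝕜)) π = if z = W then 1 else 0 := by
    intro W
    rw [patWeight_map_ext, prod_boole]
    simp only [hsome, Option.some.injEq, mem_univ, true_implies]
    exact if_congr funext_iff.symm rfl rfl
  simp only [hprod]
  rw [sum_ite_eq]
  have h0 : (0 : ℝ) ≤ (if z i = w then (1 : ℝ) else 0) * ∏ j ∈ J, (if A j (z j) = true then (1 : ℝ) else 0) :=
    mul_nonneg (by split_ifs <;> norm_num) (prod_nonneg fun j _ => by split_ifs <;> norm_num)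
  by_cases hmem : z ∈ univ.filter (fun W : Fin r → Γ => W i = w ∧ ∀ j ∈ J, A j (W j) = true)
  · rw [if_pos hmem]
    obtain ⟨hi, hJ⟩ := (mem_filter.1 hmem).2
    rw [if_pos (show Z (π[(i : ℕ)]'(lt_of_lt_of_le i.2 hr)).1 = w from hi), one_mul,
      prod_eq_one fun j hj => if_pos (show A j (Z (π[(j : ℕ)]'(lt_of_lt_of_le j.2 hr)).1) = true from hJ j hj)]
  · rw [if_neg hmem]
    exact h0

/-- **The weighted constrained output-label sum of the derivative steps**: for a tree weight,
`Σ_W wt(W) weight(Z, ∂_W, π) ≤ wt(Z) [Z_{p_i} = w] ∏_{j∈J} [A_j(Z_{p_j})]`. [folklore] -/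
private theorem sum_filter_wt_patWeight_map_ext_le_prescribed' (hwt : IsTreeWeight wt) {N : ℕ} (Z : Fin N → Γ) {r : ℕ}
    (i : Fin r) (w : Γ) (J : Finset (Fin r)) (A : Fin r → Γ → Bool) (π : List (Fin N × Fin N)) (hr : r ≤ π.length) :
    ∑ W ∈ univ.filter (fun W : Fin r → Γ => W i = w ∧ ∀ j ∈ J, A j (W j) = true),
        wt (univ.image W) * patWeight Z ((List.ofFn W).map DelOp.ext : List (DelOp Γ 𝕜)) π ≤
      wt (univ.image Z) * ((if Z (π[(i : ℕ)]'(lt_of_lt_of_le i.2 hr)).1 = w then (1 : ℝ) else 0) *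
        ∏ j ∈ J, (if A j (Z (π[(j : ℕ)]'(lt_of_lt_of_le j.2 hr)).1) = true then (1 : ℝ) else 0)) := by
  calc ∑ W ∈ univ.filter (fun W : Fin r → Γ => W i = w ∧ ∀ j ∈ J, A j (W j) = true),
          wt (univ.image W) * patWeight Z ((List.ofFn W).map DelOp.ext : List (DelOp Γ 𝕜)) π
      ≤ ∑ W ∈ univ.filter (fun W : Fin r → Γ => W i = w ∧ ∀ j ∈ J, A j (W j) = true),
          wt (univ.image Z) * patWeight Z ((List.ofFn W).map DelOp.ext : List (DelOp Γ 𝕜)) π := by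
        refine sum_le_sum fun W _ => ?_
        by_cases h : patWeight Z ((List.ofFn W).map DelOp.ext : List (DelOp Γ 𝕜)) π = 0
        · rw [h, mul_zero, mul_zero]
        · exact mul_le_mul_of_nonneg_right (hwt.mono (image_subset_of_patWeight_map_ext_ne_zero Z W π h)) (patWeight_nonneg _ _ _)
    _ ≤ _ := by
        rw [← mul_sum]
        exact mul_le_mul_of_nonneg_left (sum_filter_patWeight_map_ext_le_prescribed' (𝕜 := 𝕜) Z i w J A π hr) (hwt.nonneg _)

/-- **The weighted label sum of one pattern of one script with prescribed output SECTORS and oriented lines** (output slot `i`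
pinned at `w`, slots `j ∈ J` constrained to `A j`, which forces the sector `σp j`; tree rooted at `cl w`; Benfatto–Giuliani–Mastropietro
2006, proof of (2.77), §2.8 and App. A4 (A4.8)): the constrained slots landing in the vertex `u` number `F_u(π)`, the children of `u`
entered by swapped lines number `swChildren u`, and `u` enters through its LEVELLED `wt`-weighted anchored norm at level
`F_u(π) + swChildren u + [u root ∨ o u]` (`hN`: any legs sector-prescribed and one further free leg pinned; `hNsw`: the same leg
pinned in position only),
`Σ_Y ∏‖K‖ Σ_W wt(W) weight ≤ [π admissible] (c·α/2)^k ∏_u N_u(F_u(π) + swChildren u + [u = cl w ∨ o u])`.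
[cite: BenfattoGiulianiMastropietro2006, App. A4 (A4.8); proof of (2.77), §3 (3.2)-(3.8), §2.8 (2.97)-(2.98)] -/
theorem sum_kerProd_sum_wt_patWeight_le_oriented (hwt : IsTreeWeight wt) (hK : ∀ v Yv, K v Yv ≠ 0 → ∀ j, cl (Yv j) = v)
    (sec : Γ → Sec) (ov : Sec → Sec → Prop) [DecidableRel ov] {c : ℕ} (hc1 : 1 ≤ c)
    (hov : ∀ σ' : Sec, (univ.filter fun σ : Sec => ov σ σ').card ≤ c)
    (hCov : ∀ ℓ X Y, typeRestrict C cl ℓ X Y ≠ 0 → ov (sec X) (sec Y) ∧ ov (sec Y) (sec X))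
    {r : ℕ} (J : Finset (Fin r)) (A : Fin r → Γ → Bool) (σp : Fin r → Sec) (hA : ∀ j ∈ J, ∀ y, A j y = true → sec y = σp j)
    (Nv : Fin n → ℕ → ℝ) (hN0 : ∀ u F, 0 ≤ Nv u F)
    (hN : ∀ (ρ' : Fin (∑ v, deg v) → Option Sec) (u : Fin n) (j : Fin (deg u)), ρ' (blockEmb deg u j) = none → ∀ a : Γ,
      ∑ Y ∈ univ.filter (fun Y : Fin (deg u) → Γ => Y j = a),
        (if ∀ j' σ, ρ' (blockEmb deg u j') = some σ → sec (Y j') = σ then ‖K u Y‖ * wt (univ.image Y) else 0) ≤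
        Nv u (levR (vert deg) ρ' u + 1))
    (hNsw : ∀ (ρ' : Fin (∑ v, deg v) → Option Sec) (u : Fin n) (j : Fin (deg u)), ρ' (blockEmb deg u j) = none →
      ∃ g : Sec → ℝ, (∀ σ, 0 ≤ g σ) ∧
      (∀ a : Γ, ∑ Y ∈ univ.filter (fun Y : Fin (deg u) → Γ => Y j = a),
        (if ∀ j' σ, ρ' (blockEmb deg u j') = some σ → sec (Y j') = σ then ‖K u Y‖ * wt (univ.image Y) else 0) ≤
          g (sec a)) ∧
      ∑ σ, g σ ≤ Nv u (levR (vert deg) ρ' u))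
    {α : ℝ} (hα : 0 ≤ α) (hrow : ∀ ℓ X, ∑ Y, ‖typeRestrict C cl ℓ X Y‖ * wt {X, Y} ≤ α)
    (hcol : ∀ ℓ Y, ∑ X, ‖typeRestrict C cl ℓ X Y‖ * wt {X, Y} ≤ α)
    {w : Γ} {k : ℕ} (s : Script (cl w) k) (hs : s.Valid) (hcov : univ.image s.y = univ) (o : Fin n → Bool)
    (i : Fin r) (hi : i ∉ J)
    {W₀ : Fin r → Γ} {π : List (Fin (∑ v, deg v) × Fin (∑ v, deg v))} (hπ : π ∈ patSet (scriptOps C cl W₀ s) univ) :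
    ∑ Ys : (∀ v, Fin (deg v) → Γ), (∏ u, ‖K u (Ys u)‖) *
        ∑ W ∈ univ.filter (fun W : Fin r → Γ => W i = w ∧ ∀ j ∈ J, A j (W j) = true),
          wt (univ.image W) * patWeight (flat Ys) (scriptOps C cl W s) π ≤
      (if stepsOK (List.replicate r (fun _ => true) ++ s.lines.reverse.map (lapPred deg)) π then 1 else 0) *
        ((c * (α / 2)) ^ k * ∏ u, Nv u
          ((J.filter fun j : Fin r => ((π[(j : ℕ)]?).map fun pq => vert deg pq.1) = some u).card + swChildren s o u +
            if u = cl w ∨ o u = true then 1 else 0)) := by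
  classical
  set prof : Fin n → ℕ := fun u => (J.filter fun j : Fin r => ((π[(j : ℕ)]?).map fun pq => vert deg pq.1) = some u).card
    with hprof
  set D := (c * (α / 2)) ^ k * ∏ u, Nv u (prof u + swChildren s o u + if u = cl w ∨ o u = true then 1 else 0) with hD
  have hD0 : 0 ≤ D := mul_nonneg (pow_nonneg (by positivity) _) (prod_nonneg fun u _ => hN0 u _)
  have hRHS0 : 0 ≤ (if stepsOK (List.replicate r (fun _ => true) ++ s.lines.reverse.map (lapPred deg)) π then (1 : ℝ) else 0) *
      D := by
    split_ifs <;> simp [hD0]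
  set laps : List (DelOp Γ 𝕜) := s.lines.reverse.map fun ℓ => DelOp.lap (typeRestrict C cl ℓ) with hlaps
  have hG0 : ∀ Ys : ∀ v, Fin (deg v) → Γ, 0 ≤ ∏ u, ‖K u (Ys u)‖ := fun Ys => prod_nonneg fun u _ => norm_nonneg _
  -- the weights factorise: derivative steps (read on the full pattern) times Laplacian steps
  have h1 : ∀ (Ys : ∀ v, Fin (deg v) → Γ) (W : Fin r → Γ), patWeight (flat Ys) (scriptOps C cl W s) π =
      patWeight (flat Ys) ((List.ofFn W).map DelOp.ext : List (DelOp Γ 𝕜)) π * patWeight (flat Ys) laps (π.drop r) := by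
    intro Ys W
    rw [scriptOps, patWeight_append, List.length_map, List.length_ofFn]
    congr 1
    rw [patWeight_map_ext, patWeight_map_ext]
    refine prod_congr rfl fun j _ => ?_
    rw [List.getElem?_take_of_lt j.2]
  -- too short patterns carry no weight
  by_cases hr : π.length < r
  · refine le_trans (le_of_eq (sum_eq_zero fun Ys _ => ?_)) hRHS0
    rw [sum_eq_zero fun W _ => ?_, mul_zero]
    rw [h1, patWeight_map_ext_eq_zero_of_lt _ W _ hr, zero_mul, mul_zero]
  have hr' : r ≤ π.length := not_lt.1 hr
  -- the positions of the derivative steps; distinct, and avoided by the Laplacian steps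
  set pos : Fin r → Fin (∑ v, deg v) := fun j => (π[(j : ℕ)]'(lt_of_lt_of_le j.2 hr')).1 with hpos
  have hpw := pairwise_of_mem_patSet' _ _ hπ
  rw [List.pairwise_iff_getElem] at hpw
  have hdist : ∀ j j' : Fin r, j ≠ j' → pos j ≠ pos j' := by
    intro j j' hne
    rcases lt_or_gt_of_ne (Fin.val_ne_of_ne hne) with hlt | hlt
    · exact (hpw j j' (lt_of_lt_of_le j.2 hr') (lt_of_lt_of_le j'.2 hr') hlt).1.symm
    · exact (hpw j' j (lt_of_lt_of_le j'.2 hr') (lt_of_lt_of_le j.2 hr') hlt).1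
  have hlap : ∀ pq ∈ π.drop r, ∀ j : Fin r, pq.1 ≠ pos j ∧ pq.2 ≠ pos j := by
    intro pq hpq j
    obtain ⟨m, hm, rfl⟩ := List.mem_iff_getElem.1 hpq
    rw [List.getElem_drop]
    rw [List.length_drop] at hm
    exact hpw j (r + m) (lt_of_lt_of_le j.2 hr') (by omega) (by omega)
  -- the Laplacian segment: pairwise distinct slots
  have hnd' : ((π.drop r).map Prod.fst ++ (π.drop r).map Prod.snd).Nodup := nodup_drop_of_mem_patSet_scriptOps C cl s hπ
  -- the constrained slots landing in each vertex
  set T : Fin n → Finset (Fin r) := fun u => J.filter fun j : Fin r => vert deg (pos j) = u with hT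
  have hTv : ∀ u, ∀ j ∈ T u, vert deg (pos j) = u := fun u j hj => (mem_filter.1 hj).2
  have hprofT : ∀ u, prof u = (T u).card := by
    intro u
    refine congrArg card (filter_congr fun j _ => ?_)
    rw [List.getElem?_eq_getElem (lt_of_lt_of_le j.2 hr'), Option.map_some, Option.some.injEq]
  -- the prescribed sector assignment
  obtain ⟨ρ₀, hρ₀⟩ : ∃ ρ₀ : Fin (∑ v, deg v) → Option Sec,
      ρ₀ = fun p => if h : ∃ j ∈ J, pos j = p then some (σp h.choose) else none := ⟨_, rfl⟩
  have hρ₀_some : ∀ p σ, ρ₀ p = some σ → ∃ j ∈ J, pos j = p ∧ σ = σp j := by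
    intro p σ h
    rw [hρ₀] at h
    dsimp only at h
    split_ifs at h with hex
    · exact ⟨hex.choose, hex.choose_spec.1, hex.choose_spec.2, (Option.some_injective _ h).symm⟩
  have hρ₀_none : ∀ p, ρ₀ p = none ↔ ∀ j ∈ J, pos j ≠ p := by
    intro p
    rw [hρ₀]
    dsimp only
    split_ifs with hex
    · simp only [false_iff, not_forall, not_not]
      exact ⟨hex.choose, hex.choose_spec.1, hex.choose_spec.2⟩
    · simp only [true_iff]
      exact fun j hj he => hex ⟨j, hj, he⟩
  have hlevρ₀ : ∀ u, levR (vert deg) ρ₀ u = (T u).card := by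
    intro u
    unfold levR
    rw [← card_image_of_injOn (s := T u) (f := pos) fun j hj j' hj' h => by
      by_contra hne; exact hdist j j' hne h]
    refine congrArg card (Finset.ext fun τ => ?_)
    simp only [mem_filter, mem_univ, true_and, mem_image, ne_eq, hρ₀_none, not_forall, not_not]
    constructor
    · rintro ⟨hv, j, hj, he⟩
      exact ⟨j, mem_filter.2 ⟨hj, he ▸ hv⟩, he⟩
    · rintro ⟨j, hj, he⟩
      exact ⟨he ▸ (mem_filter.1 hj).2, j, (mem_filter.1 hj).1, he⟩
  -- the restricted kernel product dominates the kernel product times the prescription indicators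
  have hPR0 : ∀ x : Fin (∑ v, deg v) → Γ,
      0 ≤ ∏ u, restrictK (vert deg) sec ρ₀ (fun u x => ‖K u fun j => x (blockEmb deg u j)‖) u x := fun x =>
    prod_nonneg fun u _ => restrictK_nonneg _ _ _ (fun u x => norm_nonneg _) u x
  have hkerR : ∀ x : Fin (∑ v, deg v) → Γ,
      kerProd K x * ∏ j ∈ J, (if A j (x (pos j)) = true then (1 : ℝ) else 0) ≤
        ∏ u, restrictK (vert deg) sec ρ₀ (fun u x => ‖K u fun j => x (blockEmb deg u j)‖) u x := by
    intro x
    by_cases hall : ∀ j ∈ J, A j (x (pos j)) = true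
    · rw [prod_eq_one fun j hj => if_pos (hall j hj), mul_one, kerProd]
      refine le_of_eq (prod_congr rfl fun u _ => ?_)
      unfold restrictK
      rw [if_pos]
      intro τ _ σ hσ
      obtain ⟨j, hj, hjτ, rfl⟩ := hρ₀_some τ σ hσ
      rw [← hjτ]
      exact hA j hj _ (hall j hj)
    · obtain ⟨j₀, hj⟩ := not_forall.1 hall
      obtain ⟨hj₀, hA0⟩ := Classical.not_imp.1 hj
      rw [prod_eq_zero hj₀ (if_neg hA0), mul_zero]
      exact hPR0 x
  -- pinnable positions: not the position of a constrained derivative step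
  set Pn : Fin (∑ v, deg v) → Prop := fun p => ∀ j ∈ J, pos j ≠ p with hPn
  have hPi : Pn (pos i) := fun j hj => hdist j i (fun he => hi (he ▸ hj))
  have hPlap : ∀ pq ∈ π.drop r, Pn pq.1 ∧ Pn pq.2 :=
    fun pq hpq => ⟨fun j _ => ((hlap pq hpq j).1).symm, fun j _ => ((hlap pq hpq j).2).symm⟩
  have hρPn : ∀ τ, Pn τ → ρ₀ τ = none := fun τ hτ => (hρ₀_none τ).2 hτ
  have hp0π : ∀ pq ∈ π.drop r, pq.1 ≠ pos i ∧ pq.2 ≠ pos i := fun pq hpq => hlap pq hpq i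
  -- the weighted output-label sum
  have h2 : ∀ Ys : ∀ v, Fin (deg v) → Γ, (∏ u, ‖K u (Ys u)‖) *
      ∑ W ∈ univ.filter (fun W : Fin r → Γ => W i = w ∧ ∀ j ∈ J, A j (W j) = true),
        wt (univ.image W) * patWeight (flat Ys) (scriptOps C cl W s) π ≤
      (∏ u, ‖K u (Ys u)‖) * (wt (univ.image (flat Ys)) * ((((if flat Ys (pos i) = w then (1 : ℝ) else 0) *
        ∏ j ∈ J, (if A j (flat Ys (pos j)) = true then (1 : ℝ) else 0)) * patWeight (flat Ys) laps (π.drop r)))) := by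
    intro Ys
    refine mul_le_mul_of_nonneg_left ?_ (hG0 Ys)
    simp only [h1, ← mul_assoc]
    rw [← sum_mul]
    refine mul_le_mul_of_nonneg_right ?_ (patWeight_nonneg _ _ _)
    exact (sum_filter_wt_patWeight_map_ext_le_prescribed' (𝕜 := 𝕜) hwt (flat Ys) i w J A π hr').trans (le_of_eq (by ring))
  refine (sum_le_sum fun Ys _ => h2 Ys).trans ?_
  -- reindex by position labellings
  have h3 : ∑ Ys : (∀ v, Fin (deg v) → Γ), (∏ u, ‖K u (Ys u)‖) * (wt (univ.image (flat Ys)) *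
        ((((if flat Ys (pos i) = w then (1 : ℝ) else 0) *
        ∏ j ∈ J, (if A j (flat Ys (pos j)) = true then (1 : ℝ) else 0)) * patWeight (flat Ys) laps (π.drop r)))) =
      ∑ x : Fin (∑ v, deg v) → Γ, kerProd K x * (wt (univ.image x) *
        ((((if x (pos i) = w then (1 : ℝ) else 0) *
        ∏ j ∈ J, (if A j (x (pos j)) = true then (1 : ℝ) else 0)) * patWeight x laps (π.drop r)))) := by
    refine Fintype.sum_equiv (flatEquiv deg) _ _ fun Ys => ?_
    rw [flatEquiv_apply, ← kerProd_flat]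
  -- pass to the restricted kernels, insert the consistency constraints
  have h4 : ∀ x : Fin (∑ v, deg v) → Γ, kerProd K x * (wt (univ.image x) *
        ((((if x (pos i) = w then (1 : ℝ) else 0) *
        ∏ j ∈ J, (if A j (x (pos j)) = true then (1 : ℝ) else 0)) * patWeight x laps (π.drop r)))) ≤
      if vert deg (pos i) = cl w then
        (if x (pos i) = w then wt (univ.image x) *
          ((∏ u, restrictK (vert deg) sec ρ₀ (fun u x => ‖K u fun j => x (blockEmb deg u j)‖) u x) *
            lapWt C cl deg s.lines.reverse (π.drop r) x) else 0) else 0 := by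
    intro x
    have e1 := kerProd_mul_patWeight_laps C cl K hK x s.lines.reverse (π.drop r)
    have hw0 := hwt.nonneg (univ.image x)
    have hL0 := lapWt_nonneg C cl deg s.lines.reverse (π.drop r) x
    by_cases hv : vert deg (pos i) = cl w
    · rw [if_pos hv]
      by_cases hxw : x (pos i) = w
      · rw [if_pos hxw, if_pos hxw, one_mul]
        calc kerProd K x * (wt (univ.image x) *
              ((∏ j ∈ J, (if A j (x (pos j)) = true then (1 : ℝ) else 0)) * patWeight x laps (π.drop r)))
            = wt (univ.image x) * ((kerProd K x * patWeight x laps (π.drop r)) *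
                ∏ j ∈ J, (if A j (x (pos j)) = true then (1 : ℝ) else 0)) := by ring
          _ = wt (univ.image x) * (lapWt C cl deg s.lines.reverse (π.drop r) x *
                (kerProd K x * ∏ j ∈ J, (if A j (x (pos j)) = true then (1 : ℝ) else 0))) := by rw [e1]; ring
          _ ≤ wt (univ.image x) * (lapWt C cl deg s.lines.reverse (π.drop r) x *
                ∏ u, restrictK (vert deg) sec ρ₀ (fun u x => ‖K u fun j => x (blockEmb deg u j)‖) u x) :=
              mul_le_mul_of_nonneg_left (mul_le_mul_of_nonneg_left (hkerR x) hL0) hw0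
          _ = _ := by ring
      · rw [if_neg hxw, if_neg hxw]
        simp only [zero_mul, mul_zero, le_refl]
    · rw [if_neg hv]
      by_cases hxw : x (pos i) = w
      · have e2 := kerProd_mul_ite_eq cl K hK x (pos i) w (1 : ℝ)
        rw [if_neg hv, if_pos hxw, mul_one] at e2
        rw [e2]
        simp only [zero_mul, le_refl]
      · rw [if_neg hxw]
        simp only [zero_mul, mul_zero, le_refl]
  rw [h3]
  refine (sum_le_sum fun x _ => h4 x).trans ?_
  by_cases hv : vert deg (pos i) = cl w
  swap
  · simp only [hv, if_false, sum_const_zero]; exact hRHS0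
  simp only [hv, if_true]
  rw [← sum_filter]
  by_cases hc : stepsOK (s.lines.reverse.map (lapPred deg)) (π.drop r) = true
  · rw [stepsOK_append, List.length_replicate, stepsOK_replicate_true, hc, Bool.and_true,
      if_pos (by rw [decide_eq_true_iff, List.length_take, min_eq_left hr']), one_mul]
    have hmain := sum_wt_kerProdR_mul_lapWt_le_oriented C cl K hwt Pn sec ov hc1 hov hCov Nv hN0
      (fun ρ' u j _ hρ' a => hN ρ' u j hρ' a) (fun ρ' u j _ hρ' => hNsw ρ' u j hρ') hα hrow hcol s hs hcov (π.drop r)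
      hPlap hnd' o ρ₀ hρPn (pos i) hv hPi hp0π w
    refine hmain.trans (le_of_eq ?_)
    rw [hD]
    congr 1
    refine prod_congr rfl fun u _ => ?_
    rw [hlevρ₀, hprofT]
  · refine le_trans (le_of_eq (sum_eq_zero fun x _ => ?_)) hRHS0
    rw [lapWt_eq C cl x _ _ (List.nodup_reverse.2 (Script.nodup_lines s hs)), if_neg hc, mul_zero, mul_zero]

end Literature.MathematicalPhysics.QuantumLattice
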